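import Summits.Ventures.Crystal3D.Theorems.StickyWulffConstantCoaxialWallLawLayeredLocal
import Summits.Ventures.Crystal3D.Theorems.StickyWulffConstantCoaxialWallLawInPlaneSlot
import Summits.Ventures.Crystal3D.Theorems.StickyWulffConstantCoaxialWallLawHaggConst
import Summits.Ventures.Crystal3D.Theorems.StickyWulffConstantCoaxialWallLawRigidAll
import HarnessLib

/-!
# The layered (on-site) rung of `stub_coaxialTwoSlabAdhesion`, III: frame facts of a co-axial pair (in-plane periods, the layer shift, disjointness)

HONEST FRAMING. Part of the venture `Summits/Ventures/Crystal3D` (cell `crystal3d-full`), helper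
`--supports` the crux `CoaxialWallLaw` (stmt-Ventures-19481, `route-Ventures-StickyWulffConstant`),
REGISTERED line `WallLedgerF` (planner cf-p1 gen 16), open stub `stub_coaxialTwoSlabAdhesion`.
Frame bookkeeping for the layered rung (`…CoaxialWallLawLayered`): the hypotheses of the located
run-end counts `…CoaxialWallLawInPlaneRunEnds.card_inPlane_runEnds_ge_of_disjoint/_of_shift` discharged
from the crux's co-axiality data `Λ₁ = A₁·Λ₀ + t₁ ⊆ L·B(σ) + s₁`, `Λ₂ = A₂·Λ₀ + t₂ ⊆ L·B(σ') + s₂`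
(`σ, σ'` Hägg; by `…HaggConst` both are constant, `σ ≡ c₁`, `σ' ≡ c₂`, `cᵢ = ±1`).  RUNG CREDIT ONLY;
F-C1 not moved.

* `exists_up_slot_of_inPlane_class` — each in-plane class `v ∈ {u₁, u₂, u₂ − u₁}` of the shared frame
  (indeed any unit `i u₁ + j u₂`) is, up to sign, a NON-DESCENDING slot of grain 1: `A₁ w = L (ε v)`,
  `ε = ±1`, `⟪A₁ w, e₃⟫ ≥ 0`.
* `inPlane_classes_ne` — the signed classes `±u₁, ±u₂, ±(u₂ − u₁)` of different classes never coincide.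
* `coaxial_layerShift` — THE LAYER SHIFT `g = L (c₁ w + ν)` (one layer up in grain 1's stacking):
  `‖g‖ = 1`, `Λ₁ ± g = Λ₁`, and for a TWIN pair (`c₁ ≠ c₂`) no point of `Λ₂` has `x + g` or `x + 2g` in
  `Λ₂` — the letters one and two layers up differ by `c₁ − c₂ = ±2`, `2(c₁ − c₂) = ±4 (mod 3)` from
  `Λ₂`'s (`not_mem_barlowStacking_of_not_dvd`): of three consecutive layers at most one is a composition
  layer.
* `coaxial_disjoint_of_sameWord` — for `c₁ = c₂` (translation pair) and `Λ₁ ≠ Λ₂` the grains are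
  disjoint (`movedFcc_subset_of_common_point`).

WHAT THIS IS NOT: no counting, no deficiency; F-C1 not moved.
-/

noncomputable section

namespace Summit.Ventures.Crystal3D.Theorems

open Summit.Ventures.Crystal3D Finset
open Literature.MathematicalPhysics.StatisticalMechanics (fccStacking barlowStacking barlowPos barlowPos_mem
  IsHaggSeq haggLabel haggLabel_succ triangularVec₁ triangularVec₂ barlowOffset layerNormal)
open scoped InnerProductSpace

/-! ## In-plane classes are non-descending slots of the grain, up to sign -/

/-- **An in-plane class is a non-descending slot of a co-axial grain, up to sign.**  For `Λ = A·Λ₀ + t`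
inside the frame `(L, s, σ)` and a unit in-plane class vector `v = i u₁ + j u₂`: there are a sign `ε` and a
slot `w` with `A w = L (ε v)` and `⟪A w, e₃⟫ ≥ 0`. -/
theorem exists_up_slot_of_inPlane_class
    (A : EuclideanSpace ℝ (Fin 3) ≃ₗᵢ[ℝ] EuclideanSpace ℝ (Fin 3)) (t : EuclideanSpace ℝ (Fin 3))
    (L : EuclideanSpace ℝ (Fin 3) ≃ₗᵢ[ℝ] EuclideanSpace ℝ (Fin 3)) (s : EuclideanSpace ℝ (Fin 3))
    {σ : ℤ → ℤ} (hσ : IsHaggSeq σ)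
    (hsub : (fun p => A p + t) '' fccStacking 1 (Real.sqrt (2 / 3)) ⊆
      (fun p => L p + s) '' barlowStacking 1 (Real.sqrt (2 / 3)) σ)
    (i j : ℤ) (hv : ‖(i : ℝ) • triangularVec₁ (1 : ℝ) + (j : ℝ) • triangularVec₂ 1‖ = 1) :
    ∃ ε : ℝ, (ε = 1 ∨ ε = -1) ∧ ∃ w ∈ fccSlots,
      A w = L (ε • ((i : ℝ) • triangularVec₁ (1 : ℝ) + (j : ℝ) • triangularVec₂ 1)) ∧
      0 ≤ ⟪A w, EuclideanSpace.single (2 : Fin 3) (1 : ℝ)⟫_ℝ := by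
  set v : EuclideanSpace ℝ (Fin 3) := (i : ℝ) • triangularVec₁ (1 : ℝ) + (j : ℝ) • triangularVec₂ 1 with hvdef
  obtain ⟨w₀, hw₀⟩ : ∃ w₀, w₀ ∈ fccSlots := Finset.card_pos.1 (by rw [card_fccSlots]; norm_num)
  have hx : A w₀ + t ∈ (fun p => A p + t) '' fccStacking 1 (Real.sqrt (2 / 3)) :=
    ⟨w₀, mem_fcc_of_mem_fccSlots hw₀, rfl⟩
  have hy := coaxial_inPlane_slot_mem A t L s hσ hsub hx i j
  obtain ⟨w, hw, hAw⟩ := exists_slot_eq_of_mem_sub A t hx hy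
    (by rw [add_sub_cancel_left, LinearIsometryEquiv.norm_map, hv])
  rw [add_sub_cancel_left] at hAw
  by_cases hsgn : 0 ≤ ⟪A w, EuclideanSpace.single (2 : Fin 3) (1 : ℝ)⟫_ℝ
  · exact ⟨1, Or.inl rfl, w, hw, by rw [one_smul, hAw], hsgn⟩
  · refine ⟨-1, Or.inr rfl, -w, neg_mem_fccSlots hw, ?_, ?_⟩
    · rw [map_neg, hAw, neg_one_smul, map_neg]
    · rw [map_neg, inner_neg_left]; linarith

/-- **Signed in-plane classes of different classes never coincide.** -/
theorem inPlane_classes_ne {ε ε' : ℝ} (hε : ε = 1 ∨ ε = -1) (hε' : ε' = 1 ∨ ε' = -1) :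
    ε • triangularVec₁ (1 : ℝ) ≠ ε' • triangularVec₂ (1 : ℝ) ∧
      ε • triangularVec₁ (1 : ℝ) ≠ ε' • (triangularVec₂ (1 : ℝ) - triangularVec₁ 1) ∧
      ε • triangularVec₂ (1 : ℝ) ≠ ε' • (triangularVec₂ (1 : ℝ) - triangularVec₁ 1) := by
  have a0 : triangularVec₁ (1 : ℝ) 0 = 1 := by simp [triangularVec₁]
  have a1 : triangularVec₁ (1 : ℝ) 1 = 0 := by simp [triangularVec₁]
  have b0 : triangularVec₂ (1 : ℝ) 0 = 1 / 2 := by simp [triangularVec₂]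
  have b1 : triangularVec₂ (1 : ℝ) 1 = Real.sqrt 3 / 2 := by simp [triangularVec₂]
  have h3 : 0 < Real.sqrt 3 := Real.sqrt_pos.2 (by norm_num)
  have hε0 : ε ≠ 0 := by rcases hε with rfl | rfl <;> norm_num
  have hε'0 : ε' ≠ 0 := by rcases hε' with rfl | rfl <;> norm_num
  refine ⟨?_, ?_, ?_⟩
  · intro h
    have h1 := congrArg (fun x : EuclideanSpace ℝ (Fin 3) => x 1) h
    simp only [PiLp.smul_apply, smul_eq_mul, a1, b1, mul_zero] at h1
    have : ε' * Real.sqrt 3 = 0 := by linarith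
    rcases mul_eq_zero.1 this with h' | h'
    · exact hε'0 h'
    · linarith
  · intro h
    have h1 := congrArg (fun x : EuclideanSpace ℝ (Fin 3) => x 1) h
    simp only [PiLp.smul_apply, PiLp.sub_apply, smul_eq_mul, a1, b1, mul_zero, sub_zero] at h1
    have : ε' * Real.sqrt 3 = 0 := by linarith
    rcases mul_eq_zero.1 this with h' | h'
    · exact hε'0 h'
    · linarith
  · intro h
    have h0 := congrArg (fun x : EuclideanSpace ℝ (Fin 3) => x 0) h
    have h1 := congrArg (fun x : EuclideanSpace ℝ (Fin 3) => x 1) h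
    simp only [PiLp.smul_apply, PiLp.sub_apply, smul_eq_mul, a0, a1, b0, b1, sub_zero] at h0 h1
    have hεε : ε = ε' := by
      have : (ε - ε') * Real.sqrt 3 = 0 := by linarith
      rcases mul_eq_zero.1 this with h' | h'
      · linarith
      · linarith
    rw [hεε] at h0
    have : ε' = 0 := by linarith
    exact hε'0 this

/-! ## The layer shift of a co-axial pair -/

/-- One step up in a stacking with CONSTANT Hägg sequence: `site (k+1, i, j) = site (k, i, j) + (σ₀ w + ν)`. -/
theorem barlowPos_succ_of_const {σ : ℤ → ℤ} (hc : ∀ k, σ k = σ 0) (k i j : ℤ) :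
    barlowPos 1 (Real.sqrt (2 / 3)) σ (k + 1) i j =
      barlowPos 1 (Real.sqrt (2 / 3)) σ k i j +
        (((σ 0 : ℤ) : ℝ) • barlowOffset (1 : ℝ) + layerNormal (Real.sqrt (2 / 3))) := by
  rw [barlowPos_eq_combo, barlowPos_eq_combo, haggLabel_succ, hc k]
  push_cast
  module

/-- **The layer shift.**  See the module docstring.  `g = L (c₁ w + ν)`, `c₁ = σ 0`. -/
theorem coaxial_layerShift
    (A₁ : EuclideanSpace ℝ (Fin 3) ≃ₗᵢ[ℝ] EuclideanSpace ℝ (Fin 3)) (t₁ : EuclideanSpace ℝ (Fin 3))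
    (A₂ : EuclideanSpace ℝ (Fin 3) ≃ₗᵢ[ℝ] EuclideanSpace ℝ (Fin 3)) (t₂ : EuclideanSpace ℝ (Fin 3))
    (L : EuclideanSpace ℝ (Fin 3) ≃ₗᵢ[ℝ] EuclideanSpace ℝ (Fin 3)) (s₁ s₂ : EuclideanSpace ℝ (Fin 3))
    {σ σ' : ℤ → ℤ} (hσ : IsHaggSeq σ) (hσ' : IsHaggSeq σ')
    (hsub₁ : (fun p => A₁ p + t₁) '' fccStacking 1 (Real.sqrt (2 / 3)) ⊆
      (fun p => L p + s₁) '' barlowStacking 1 (Real.sqrt (2 / 3)) σ)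
    (hsub₂ : (fun p => A₂ p + t₂) '' fccStacking 1 (Real.sqrt (2 / 3)) ⊆
      (fun p => L p + s₂) '' barlowStacking 1 (Real.sqrt (2 / 3)) σ') :
    ‖L (((σ 0 : ℤ) : ℝ) • barlowOffset (1 : ℝ) + layerNormal (Real.sqrt (2 / 3)))‖ = 1 ∧
    (∀ p ∈ (fun p => A₁ p + t₁) '' fccStacking 1 (Real.sqrt (2 / 3)),
      p + L (((σ 0 : ℤ) : ℝ) • barlowOffset (1 : ℝ) + layerNormal (Real.sqrt (2 / 3))) ∈
        (fun p => A₁ p + t₁) '' fccStacking 1 (Real.sqrt (2 / 3)) ∧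
      p - L (((σ 0 : ℤ) : ℝ) • barlowOffset (1 : ℝ) + layerNormal (Real.sqrt (2 / 3))) ∈
        (fun p => A₁ p + t₁) '' fccStacking 1 (Real.sqrt (2 / 3))) ∧
    (σ 0 ≠ σ' 0 → ∀ x ∈ (fun p => A₂ p + t₂) '' fccStacking 1 (Real.sqrt (2 / 3)),
      x + L (((σ 0 : ℤ) : ℝ) • barlowOffset (1 : ℝ) + layerNormal (Real.sqrt (2 / 3))) ∉
        (fun p => A₂ p + t₂) '' fccStacking 1 (Real.sqrt (2 / 3)) ∧
      x + (2 : ℝ) • L (((σ 0 : ℤ) : ℝ) • barlowOffset (1 : ℝ) + layerNormal (Real.sqrt (2 / 3))) ∉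
        (fun p => A₂ p + t₂) '' fccStacking 1 (Real.sqrt (2 / 3))) := by
  set c₁ : ℤ := σ 0 with hc₁
  set c₂ : ℤ := σ' 0 with hc₂
  set g₀ : EuclideanSpace ℝ (Fin 3) := ((c₁ : ℤ) : ℝ) • barlowOffset (1 : ℝ) + layerNormal (Real.sqrt (2 / 3))
    with hg₀
  have hconst₁ : ∀ k, σ k = σ 0 := fun k => coaxial_hagg_const A₁ t₁ L s₁ hσ hsub₁ k
  have hconst₂ : ∀ k, σ' k = σ' 0 := fun k => coaxial_hagg_const A₂ t₂ L s₂ hσ' hsub₂ k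
  have heq₁ := movedFcc_eq_barlowImage A₁ t₁ L s₁ hσ hsub₁
  have heq₂ := movedFcc_eq_barlowImage A₂ t₂ L s₂ hσ' hsub₂
  have hc₁u : c₁ = 1 ∨ c₁ = -1 := hσ 0
  have hc₂u : c₂ = 1 ∨ c₂ = -1 := hσ' 0
  refine ⟨?_, ?_, ?_⟩
  · -- the norm: `12 ‖c₁ w + ν‖² = 3c₁² + c₁² + 8 = 12`
    rw [LinearIsometryEquiv.norm_map]
    have h12 := twelve_mul_norm_site_sq 0 0 c₁ 1
    have e : ((0 : ℤ) : ℝ) • triangularVec₁ (1 : ℝ) + ((0 : ℤ) : ℝ) • triangularVec₂ (1 : ℝ) +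
        ((c₁ : ℤ) : ℝ) • barlowOffset (1 : ℝ) + ((1 : ℤ) : ℝ) • layerNormal (Real.sqrt (2 / 3)) = g₀ := by
      rw [hg₀]; push_cast; module
    rw [e] at h12
    have hsq : (3 * (2 * 0 + 0 + c₁) ^ 2 + (3 * 0 + c₁) ^ 2 + 8 * (1 : ℤ) ^ 2 : ℤ) = 12 := by
      rcases hc₁u with h | h <;> rw [h] <;> norm_num
    rw [hsq] at h12
    push_cast at h12
    have hn : ‖g₀‖ ^ 2 = 1 := by linarith
    have hnn : 0 ≤ ‖g₀‖ := norm_nonneg _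
    nlinarith [hn, hnn]
  · -- `Λ₁ ± g = Λ₁`
    intro p hp
    rw [heq₁] at hp ⊢
    obtain ⟨q, ⟨k, i, j, rfl⟩, rfl⟩ := hp
    constructor
    · refine ⟨barlowPos 1 (Real.sqrt (2 / 3)) σ (k + 1) i j, barlowPos_mem _ _ _, ?_⟩
      show L (barlowPos 1 (Real.sqrt (2 / 3)) σ (k + 1) i j) + s₁ =
        L (barlowPos 1 (Real.sqrt (2 / 3)) σ k i j) + s₁ + L g₀
      rw [barlowPos_succ_of_const hconst₁, map_add]
      abel
    · refine ⟨barlowPos 1 (Real.sqrt (2 / 3)) σ (k - 1) i j, barlowPos_mem _ _ _, ?_⟩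
      show L (barlowPos 1 (Real.sqrt (2 / 3)) σ (k - 1) i j) + s₁ =
        L (barlowPos 1 (Real.sqrt (2 / 3)) σ k i j) + s₁ - L g₀
      have e := barlowPos_succ_of_const hconst₁ (k - 1) i j
      rw [sub_add_cancel] at e
      rw [e, map_add]
      abel
  · -- twin pair: one and two layers up leave `Λ₂`
    intro htw x hx
    have hc₂' : c₂ = -c₁ := by
      rcases hc₁u with h | h <;> rcases hc₂u with h' | h' <;> rw [h, h'] at htw ⊢ <;> omega
    rw [heq₂] at hx
    obtain ⟨q, ⟨k, i, j, rfl⟩, rfl⟩ := hx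
    -- the letters of the shifted points
    have hLadd : ∀ a b : EuclideanSpace ℝ (Fin 3), L a + s₂ + L b = L (a + b) + s₂ := by
      intro a b; rw [map_add]; abel
    have hshift : ∀ m : ℤ, L (barlowPos 1 (Real.sqrt (2 / 3)) σ' k i j) + s₂ + ((m : ℤ) : ℝ) • L g₀ =
        L ((i : ℝ) • triangularVec₁ (1 : ℝ) + (j : ℝ) • triangularVec₂ (1 : ℝ) +
          ((haggLabel σ' k + m * c₁ : ℤ) : ℝ) • barlowOffset (1 : ℝ) +
          ((k + m : ℤ) : ℝ) • layerNormal (Real.sqrt (2 / 3))) + s₂ := by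
      intro m
      rw [← LinearIsometryEquiv.map_smul, hLadd]
      congr 2
      rw [barlowPos_eq_combo, hg₀]
      push_cast
      module
    have hlab : ∀ m : ℤ, haggLabel σ' (k + m) = haggLabel σ' k + m * c₂ := by
      intro m
      induction m using Int.induction_on with
      | zero => simp
      | succ n ih =>
        rw [show k + ((n : ℤ) + 1) = (k + n) + 1 by ring, haggLabel_succ, ih, hconst₂ (k + n)]
        rw [hc₂]; ring
      | pred n ih =>
        have e := haggLabel_succ σ' (k + (-(n : ℤ) - 1))
        rw [show k + (-(n : ℤ) - 1) + 1 = k + -(n : ℤ) by ring, hconst₂] at e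
        rw [hc₂] at ih ⊢
        linarith
    have hnot : ∀ m : ℤ, ¬ (3 : ℤ) ∣ m * (c₁ - c₂) →
        L (barlowPos 1 (Real.sqrt (2 / 3)) σ' k i j) + s₂ + ((m : ℤ) : ℝ) • L g₀ ∉
          (fun p => L p + s₂) '' barlowStacking 1 (Real.sqrt (2 / 3)) σ' := by
      intro m hm hmem
      rw [hshift m] at hmem
      obtain ⟨b, hb, hbe⟩ := hmem
      have hbeq : b = (i : ℝ) • triangularVec₁ (1 : ℝ) + (j : ℝ) • triangularVec₂ (1 : ℝ) +
          ((haggLabel σ' k + m * c₁ : ℤ) : ℝ) • barlowOffset (1 : ℝ) +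
          ((k + m : ℤ) : ℝ) • layerNormal (Real.sqrt (2 / 3)) :=
        L.injective (add_right_cancel hbe)
      have hnd : ¬ (3 : ℤ) ∣ (haggLabel σ' k + m * c₁) - haggLabel σ' (k + m) := by
        rw [hlab m, show haggLabel σ' k + m * c₁ - (haggLabel σ' k + m * c₂) = m * (c₁ - c₂) by ring]
        exact hm
      have := not_mem_barlowStacking_of_not_dvd σ' i j (haggLabel σ' k + m * c₁) (k + m) hnd
      rw [← hbeq] at this
      exact this hb
    have hd12 : c₁ - c₂ = 2 * c₁ := by rw [hc₂']; ring
    constructor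
    · have h := hnot 1 (by
        rw [hd12]; rcases hc₁u with h | h <;> rw [h] <;> decide)
      rw [heq₂]
      simpa using h
    · have h := hnot 2 (by
        rw [hd12]; rcases hc₁u with h | h <;> rw [h] <;> decide)
      rw [heq₂]
      simpa using h

/-! ## Translation pairs are disjoint -/

/-- **A co-axial pair with the same stacking word and `Λ₁ ≠ Λ₂` is disjoint.** -/
theorem coaxial_disjoint_of_sameWord
    (A₁ : EuclideanSpace ℝ (Fin 3) ≃ₗᵢ[ℝ] EuclideanSpace ℝ (Fin 3)) (t₁ : EuclideanSpace ℝ (Fin 3))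
    (A₂ : EuclideanSpace ℝ (Fin 3) ≃ₗᵢ[ℝ] EuclideanSpace ℝ (Fin 3)) (t₂ : EuclideanSpace ℝ (Fin 3))
    (L : EuclideanSpace ℝ (Fin 3) ≃ₗᵢ[ℝ] EuclideanSpace ℝ (Fin 3)) (s₁ s₂ : EuclideanSpace ℝ (Fin 3))
    {σ σ' : ℤ → ℤ} (hσ : IsHaggSeq σ) (hσ' : IsHaggSeq σ')
    (hsub₁ : (fun p => A₁ p + t₁) '' fccStacking 1 (Real.sqrt (2 / 3)) ⊆
      (fun p => L p + s₁) '' barlowStacking 1 (Real.sqrt (2 / 3)) σ)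
    (hsub₂ : (fun p => A₂ p + t₂) '' fccStacking 1 (Real.sqrt (2 / 3)) ⊆
      (fun p => L p + s₂) '' barlowStacking 1 (Real.sqrt (2 / 3)) σ')
    (hsame : σ 0 = σ' 0)
    (hne : (fun p => A₁ p + t₁) '' fccStacking 1 (Real.sqrt (2 / 3)) ≠
      (fun p => A₂ p + t₂) '' fccStacking 1 (Real.sqrt (2 / 3))) :
    ∀ p ∈ (fun p => A₁ p + t₁) '' fccStacking 1 (Real.sqrt (2 / 3)),
      p ∉ (fun p => A₂ p + t₂) '' fccStacking 1 (Real.sqrt (2 / 3)) := by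
  intro p hp₁ hp₂
  obtain ⟨-, e₁⟩ := linear_image_eq_frame_of_subset A₁ L t₁ s₁ hσ hsub₁
  obtain ⟨-, e₂⟩ := linear_image_eq_frame_of_subset A₂ L t₂ s₂ hσ' hsub₂
  have hlin : A₁ '' fccStacking 1 (Real.sqrt (2 / 3)) = A₂ '' fccStacking 1 (Real.sqrt (2 / 3)) := by
    rw [e₁, e₂, hsame]
  exact hne (Set.Subset.antisymm (movedFcc_subset_of_common_point A₁ t₁ A₂ t₂ hlin hp₁ hp₂)
    (movedFcc_subset_of_common_point A₂ t₂ A₁ t₁ hlin.symm hp₂ hp₁))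

end Summit.Ventures.Crystal3D.Theorems

end
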